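import Literature.Analysis.FluidPDE.StokesTorusFrameBound
import Literature.Analysis.FunctionSpaces.TorusSpectralWeakDerivative
import Literature.Analysis.FunctionSpaces.TorusSobolevNormFacts
import HarnessLib

/-!
# The frame `S = (1 + A)^{-1/2}` is an `H → H¹` norm equivalence on the energy space of the flat torus

Analysis/FluidPDE support file (everything proved; no definitions, no named facts), companion of
`StokesTorusFrameBound.lean`.  Let `b` be a Hilbert basis of the energy space `H = Torus.energySpace d`
consisting of Stokes modes `Torus.stokesModeL2 k a c` with symbol `m i = 4π²|kᵢ|²`, and
`S : H →L[ℝ] H` diagonal, `S (b i) = (1 + m i)^{-1/2} b i` (Constantin–Foias 1988, Ch. 4,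
(4.11)–(4.13)).  The frame bound of `StokesTorusFrameBound.lean` says
`‖S y‖²_{L²} + ‖∇(S y)‖²_{L²} ≤ ‖y‖²`; here we add the converse direction (up to the harmless factor `2`,
which avoids Minkowski's inequality in the weighted `ℓ²`), so that CONVERGENCE IN `H` OF FRAME PREIMAGES
can be read off `H¹`-convergence of the states:

* `Torus.tsum_one_add_stokesEigenvalue_mul_enorm_sq_eq_add` — for an `L²` class `v`,
  `∑_k (1 + 4π²|k|²) ‖v̂(k)‖² = ‖v‖² + ‖∇v‖₂²` in `[0, ∞]` (Parseval + `Torus.eGradNormSq_eq_tsum`);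
* `Torus.ofReal_norm_sq_le_two_mul_tsum_frame` — `‖y‖² ≤ 2 ∑_k (1 + 4π²|k|²) ‖𝓕(S y)(k)‖²`: for the
  truncations `y_F` of `y` in the basis, `‖y_F‖² = ∑_k (1 + 4π²|k|²)‖𝓕(S y_F)(k)‖²`
  (`Torus.tsum_one_add_stokesEigenvalue_mul_enorm_sq_eq` on the Stokes graph pair of a finite
  combination of modes), `‖a + b‖² ≤ 2‖a‖² + 2‖b‖²` coefficientwise, and the frame bound applied to
  `y_F − y → 0`;
* `Torus.frame_norm_sq_equivalence` — the user-facing form: `‖∇(S y)‖₂² < ∞`,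
  `‖S y‖² + ‖∇(S y)‖₂² ≤ ‖y‖²` and `‖y‖² ≤ 2 (‖S y‖² + ‖∇(S y)‖₂²)`.

## References

* P. Constantin, C. Foias, *Navier–Stokes Equations*, Univ. Chicago Press (1988), Ch. 4,
  (4.4)–(4.7), (4.11)–(4.13), (4.33)–(4.37). [ConstantinFoiasNSE1988]
-/

noncomputable section

open MeasureTheory Filter UnitAddTorus
open scoped InnerProductSpace RealInnerProductSpace ENNReal Topology

namespace Literature.Analysis.FluidPDE

namespace Torus

variable {d : Type*} [Fintype d] [DecidableEq d]

/-! ### The `V`-weighted coefficient sum of an `L²` class -/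

omit [DecidableEq d] in
/-- **`∑_k (1 + 4π²|k|²) ‖v̂(k)‖² = ‖v‖² + ‖∇v‖₂²`** in `[0, ∞]` for every `v ∈ L²(T^d; ℝ^d)`: Parseval
(`Torus.hasSum_re_inner_mFourierCoeff_inner`) for the first summand and the spectral formula
`Torus.eGradNormSq_eq_tsum` (`‖∇v‖₂² = 4π² ∑_k |k|² ‖v̂(k)‖²`) for the second
(Constantin–Foias 1988, Ch. 4, (4.33)–(4.37)). [folklore] -/
theorem tsum_one_add_stokesEigenvalue_mul_enorm_sq_eq_add
    (v : Lp (EuclideanSpace ℝ d) 2 (volume : Measure (UnitAddTorus d))) :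
    ∑' k : d → ℤ, ENNReal.ofReal (1 + stokesEigenvalue k) *
        ‖mFourierCoeff (FunctionSpaces.EuclideanSpace.complexify ∘
          (v : UnitAddTorus d → EuclideanSpace ℝ d)) k‖ₑ ^ 2 =
      ENNReal.ofReal (‖v‖ ^ 2) +
        FunctionSpaces.Torus.eGradNormSq (v : UnitAddTorus d → EuclideanSpace ℝ d) := by
  set cv : (d → ℤ) → EuclideanSpace ℂ d := fun k =>
    mFourierCoeff (FunctionSpaces.EuclideanSpace.complexify ∘ (v : UnitAddTorus d → EuclideanSpace ℝ d)) k
    with hcv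
  -- Parseval for `‖v‖²`
  have h1 : HasSum (fun k : d → ℤ => ‖cv k‖ ^ 2) (‖v‖ ^ 2) := by
    have h := hasSum_re_inner_mFourierCoeff_inner v v
    rw [real_inner_self_eq_norm_sq] at h
    convert h using 1
    funext k
    rw [inner_self_eq_norm_sq_to_K]
    norm_cast
  have h1' : ∑' k : d → ℤ, ‖cv k‖ₑ ^ 2 = ENNReal.ofReal (‖v‖ ^ 2) := by
    rw [← h1.tsum_eq, ENNReal.ofReal_tsum_of_nonneg (fun k => sq_nonneg _) h1.summable]
    refine tsum_congr fun k => ?_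
    rw [← ofReal_norm, ENNReal.ofReal_pow (norm_nonneg _)]
  -- split the weight `1 + 4π²|k|²`
  have hsplit : ∀ k : d → ℤ, ENNReal.ofReal (1 + stokesEigenvalue k) * ‖cv k‖ₑ ^ 2 =
      ‖cv k‖ₑ ^ 2 + ENNReal.ofReal (4 * Real.pi ^ 2) *
        (ENNReal.ofReal (FunctionSpaces.Torus.freqNormSq k) * ‖cv k‖ₑ ^ 2) := fun k => by
    have h4 : (0 : ℝ) ≤ 4 * Real.pi ^ 2 := by positivity
    rw [ENNReal.ofReal_add zero_le_one (stokesEigenvalue_nonneg k), add_mul, ENNReal.ofReal_one, one_mul,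
      stokesEigenvalue, ENNReal.ofReal_mul h4, mul_assoc]
  calc ∑' k : d → ℤ, ENNReal.ofReal (1 + stokesEigenvalue k) * ‖cv k‖ₑ ^ 2
      = ∑' k : d → ℤ, (‖cv k‖ₑ ^ 2 + ENNReal.ofReal (4 * Real.pi ^ 2) *
          (ENNReal.ofReal (FunctionSpaces.Torus.freqNormSq k) * ‖cv k‖ₑ ^ 2)) := tsum_congr hsplit
    _ = (∑' k : d → ℤ, ‖cv k‖ₑ ^ 2) + ENNReal.ofReal (4 * Real.pi ^ 2) *
          ∑' k : d → ℤ, ENNReal.ofReal (FunctionSpaces.Torus.freqNormSq k) * ‖cv k‖ₑ ^ 2 := by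
        rw [ENNReal.tsum_add, ENNReal.tsum_mul_left]
    _ = ENNReal.ofReal (‖v‖ ^ 2) + FunctionSpaces.Torus.eGradNormSq (v : UnitAddTorus d → EuclideanSpace ℝ d) := by
        rw [h1', FunctionSpaces.Torus.eGradNormSq_eq_tsum]

/-! ### The reverse frame bound -/

set_option maxHeartbeats 400000 in
/-- **The reverse frame bound `‖y‖² ≤ 2 ∑_k (1 + 4π²|k|²) ‖𝓕(S y)(k)‖²`** for the diagonal frame
`S (b i) = (1 + m i)^{-1/2} b i` on a Hilbert basis of Stokes modes (Constantin–Foias 1988, Ch. 4,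
(4.11)–(4.13): `S = (1 + A)^{-1/2}` is an isometry of `H` onto `V = D(A^{1/2})` with the graph norm; the
factor `2` comes from `‖a + b‖² ≤ 2‖a‖² + 2‖b‖²`, used in place of Minkowski's inequality).  Proof: for a
finite set `F` of modes and the truncation `y_F = ∑_{i ∈ F} ⟪b i, y⟫ b i`, the finite combination `S y_F`
lies in the Stokes graph, so `∑_k (1 + 4π²|k|²)‖𝓕(S y_F)(k)‖² = ‖S y_F‖² + ⟪A S y_F, S y_F⟫ = ‖y_F‖²`
(`Torus.tsum_one_add_stokesEigenvalue_mul_enorm_sq_eq`); then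
`‖y_F‖² ≤ 2 Φ(S y) + 2 Φ(S (y_F − y)) ≤ 2 Φ(S y) + 2 ‖y_F − y‖²` by the frame bound
(`Torus.tsum_one_add_stokesEigenvalue_mul_enorm_sq_le`), and `y_F → y`. [folklore] -/
theorem ofReal_norm_sq_le_two_mul_tsum_frame {ι : Type*}
    (b : HilbertBasis ι ℝ (FunctionSpaces.Torus.energySpace d)) (m : ι → ℝ)
    (hb : ∀ i, ∃ (k : d → ℤ) (a : EuclideanSpace ℝ d) (c : Bool),
      ((b i : FunctionSpaces.Torus.energySpace d) :
          Lp (EuclideanSpace ℝ d) 2 (volume : Measure (UnitAddTorus d))) = stokesModeL2 k a c ∧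
        m i = stokesEigenvalue k)
    (S : FunctionSpaces.Torus.energySpace d →L[ℝ] FunctionSpaces.Torus.energySpace d)
    (hS : ∀ i, S (b i) = ((1 + m i) ^ (-(1 / 2 : ℝ))) • b i) (y : FunctionSpaces.Torus.energySpace d) :
    ENNReal.ofReal (‖y‖ ^ 2) ≤
      2 * ∑' k : d → ℤ, ENNReal.ofReal (1 + stokesEigenvalue k) *
        ‖mFourierCoeff (FunctionSpaces.EuclideanSpace.complexify ∘
          (((S y : FunctionSpaces.Torus.energySpace d) :
            Lp (EuclideanSpace ℝ d) 2 (volume : Measure (UnitAddTorus d))) :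
              UnitAddTorus d → EuclideanSpace ℝ d)) k‖ₑ ^ 2 := by
  classical
  have hm0 : ∀ i, 0 ≤ m i := fun i => by
    obtain ⟨k, a, c, -, hmi⟩ := hb i
    rw [hmi]
    exact stokesEigenvalue_nonneg k
  set σ : ι → ℝ := fun i => (1 + m i) ^ (-(1 / 2 : ℝ)) with hσ
  have hσsq : ∀ i, (1 + m i) * σ i ^ 2 = 1 := fun i => by
    have h1 : 0 < 1 + m i := by linarith [hm0 i]
    rw [hσ]
    dsimp only
    rw [← Real.rpow_natCast, ← Real.rpow_mul h1.le]
    norm_num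
    rw [Real.rpow_neg_one, mul_inv_cancel₀ h1.ne']
  -- the weighted functional on `L²` and its quasi-subadditivity
  set Φ : Lp (EuclideanSpace ℝ d) 2 (volume : Measure (UnitAddTorus d)) → ℝ≥0∞ := fun u =>
    ∑' k : d → ℤ, ENNReal.ofReal (1 + stokesEigenvalue k) *
      ‖mFourierCoeff (FunctionSpaces.EuclideanSpace.complexify ∘
        (u : UnitAddTorus d → EuclideanSpace ℝ d)) k‖ₑ ^ 2 with hΦ
  have hΦadd : ∀ u u' : Lp (EuclideanSpace ℝ d) 2 (volume : Measure (UnitAddTorus d)),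
      Φ (u + u') ≤ 2 * Φ u + 2 * Φ u' := by
    intro u u'
    simp only [hΦ]
    rw [← ENNReal.tsum_mul_left, ← ENNReal.tsum_mul_left, ← ENNReal.tsum_add]
    refine ENNReal.tsum_le_tsum fun k => ?_
    -- the coefficients of `u + u'`
    have hint : ∀ w : Lp (EuclideanSpace ℝ d) 2 (volume : Measure (UnitAddTorus d)),
        Integrable (FunctionSpaces.EuclideanSpace.complexify ∘ (w : UnitAddTorus d → EuclideanSpace ℝ d))
          volume := fun w =>
      FunctionSpaces.Torus.integrable_complexify_comp ((Lp.memLp w).integrable one_le_two)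
    have hcoef : mFourierCoeff (FunctionSpaces.EuclideanSpace.complexify ∘
          ((u + u' : Lp (EuclideanSpace ℝ d) 2 (volume : Measure (UnitAddTorus d))) :
            UnitAddTorus d → EuclideanSpace ℝ d)) k =
        mFourierCoeff (FunctionSpaces.EuclideanSpace.complexify ∘ (u : UnitAddTorus d → EuclideanSpace ℝ d)) k +
          mFourierCoeff (FunctionSpaces.EuclideanSpace.complexify ∘
            (u' : UnitAddTorus d → EuclideanSpace ℝ d)) k := by
      rw [← FunctionSpaces.Torus.mFourierCoeff_add (hint u) (hint u')]
      refine FunctionSpaces.Torus.mFourierCoeff_congr_ae ?_ k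
      filter_upwards [Lp.coeFn_add u u'] with x hx
      simp only [Function.comp_apply, hx, Pi.add_apply, map_add]
    rw [hcoef, mul_left_comm (2 : ℝ≥0∞), mul_left_comm (2 : ℝ≥0∞), ← mul_add]
    refine mul_le_mul_right ?_ _
    -- `‖a + b‖² ≤ 2‖a‖² + 2‖b‖²`
    set a := mFourierCoeff (FunctionSpaces.EuclideanSpace.complexify ∘
      (u : UnitAddTorus d → EuclideanSpace ℝ d)) k
    set a' := mFourierCoeff (FunctionSpaces.EuclideanSpace.complexify ∘
      (u' : UnitAddTorus d → EuclideanSpace ℝ d)) k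
    have hreal : ‖a + a'‖ ^ 2 ≤ 2 * ‖a‖ ^ 2 + 2 * ‖a'‖ ^ 2 := by
      have h1 : ‖a + a'‖ ^ 2 ≤ (‖a‖ + ‖a'‖) ^ 2 := pow_le_pow_left₀ (norm_nonneg _) (norm_add_le _ _) 2
      nlinarith [sq_nonneg (‖a‖ - ‖a'‖)]
    calc ‖a + a'‖ₑ ^ 2 = ENNReal.ofReal (‖a + a'‖ ^ 2) := by
          rw [← ofReal_norm, ENNReal.ofReal_pow (norm_nonneg _)]
      _ ≤ ENNReal.ofReal (2 * ‖a‖ ^ 2 + 2 * ‖a'‖ ^ 2) := ENNReal.ofReal_le_ofReal hreal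
      _ = 2 * ‖a‖ₑ ^ 2 + 2 * ‖a'‖ₑ ^ 2 := by
          rw [ENNReal.ofReal_add (by positivity) (by positivity), ENNReal.ofReal_mul zero_le_two,
            ENNReal.ofReal_mul zero_le_two, ENNReal.ofReal_ofNat, ← ofReal_norm, ← ofReal_norm,
            ENNReal.ofReal_pow (norm_nonneg _), ENNReal.ofReal_pow (norm_nonneg _)]
  -- the truncations `y_F` of `y` and their frames
  obtain ⟨yF, hyF⟩ : ∃ yF : Finset ι → FunctionSpaces.Torus.energySpace d,
      yF = fun F => ∑ i ∈ F, b.repr y i • b i := ⟨_, rfl⟩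
  have hSyF : ∀ F : Finset ι, S (yF F) = ∑ i ∈ F, (σ i * b.repr y i) • b i := fun F => by
    simp only [hyF, map_sum, map_smul, hS, smul_smul, mul_comm (b.repr y _), hσ]
  -- `Φ (S y_F) = ‖y_F‖² = ∑_{i ∈ F} ⟪b i, y⟫²`
  have hΦF : ∀ F : Finset ι,
      Φ ((S (yF F) : FunctionSpaces.Torus.energySpace d) :
        Lp (EuclideanSpace ℝ d) 2 (volume : Measure (UnitAddTorus d))) =
        ENNReal.ofReal (∑ i ∈ F, (b.repr y i) ^ 2) := by
    intro F
    set cS : ι → ℝ := fun i => σ i * b.repr y i with hcS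
    set vF : FunctionSpaces.Torus.energySpace d := ∑ i ∈ F, cS i • b i with hvF
    set wF : FunctionSpaces.Torus.energySpace d := ∑ i ∈ F, (m i * cS i) • b i with hwF
    have hgraph := isStokesImage_sum_smul b m hb cS F
    have heq := tsum_one_add_stokesEigenvalue_mul_enorm_sq_eq vF.2 wF.2 hgraph
    have hSv : S (yF F) = vF := hSyF F
    simp only [hΦ]
    rw [hSv, heq]
    congr 1
    have hn : ‖((vF : FunctionSpaces.Torus.energySpace d) :
        Lp (EuclideanSpace ℝ d) 2 (volume : Measure (UnitAddTorus d)))‖ ^ 2 = ∑ i ∈ F, cS i * cS i := by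
      rw [← real_inner_self_eq_norm_sq, ← Submodule.coe_inner, hvF]
      rw [b.orthonormal.inner_sum]
      simp
    have hi : ⟪((wF : FunctionSpaces.Torus.energySpace d) :
          Lp (EuclideanSpace ℝ d) 2 (volume : Measure (UnitAddTorus d))),
        ((vF : FunctionSpaces.Torus.energySpace d) :
          Lp (EuclideanSpace ℝ d) 2 (volume : Measure (UnitAddTorus d)))⟫_ℝ =
        ∑ i ∈ F, m i * cS i * cS i := by
      rw [← Submodule.coe_inner, hwF, hvF]
      rw [b.orthonormal.inner_sum]
      simp
    rw [hn, hi, ← Finset.sum_add_distrib]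
    refine Finset.sum_congr rfl fun i _ => ?_
    have := hσsq i
    calc cS i * cS i + m i * cS i * cS i = ((1 + m i) * σ i ^ 2) * (b.repr y i) ^ 2 := by
          simp only [hcS]; ring
      _ = (b.repr y i) ^ 2 := by rw [this, one_mul]
  -- the bound for each truncation
  have hbound : ∀ F : Finset ι, ENNReal.ofReal (∑ i ∈ F, (b.repr y i) ^ 2) ≤
      2 * Φ ((S y : FunctionSpaces.Torus.energySpace d) : Lp (EuclideanSpace ℝ d) 2 (volume : Measure (UnitAddTorus d))) +
        2 * ENNReal.ofReal (‖yF F - y‖ ^ 2) := by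
    intro F
    rw [← hΦF F]
    have hdecomp : ((S (yF F) : FunctionSpaces.Torus.energySpace d) :
        Lp (EuclideanSpace ℝ d) 2 (volume : Measure (UnitAddTorus d))) =
        ((S y : FunctionSpaces.Torus.energySpace d) : Lp (EuclideanSpace ℝ d) 2 (volume : Measure (UnitAddTorus d))) +
          ((S (yF F - y) : FunctionSpaces.Torus.energySpace d) :
            Lp (EuclideanSpace ℝ d) 2 (volume : Measure (UnitAddTorus d))) := by
      rw [← Submodule.coe_add, ← map_add, add_sub_cancel]
    rw [hdecomp]
    refine (hΦadd _ _).trans (add_le_add le_rfl (mul_le_mul_right ?_ _))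
    exact tsum_one_add_stokesEigenvalue_mul_enorm_sq_le b m hb S hS (yF F - y)
  -- pass to the limit `F → ∞`
  have hlhs : Tendsto (fun F : Finset ι => ENNReal.ofReal (∑ i ∈ F, (b.repr y i) ^ 2)) atTop
      (𝓝 (ENNReal.ofReal (‖y‖ ^ 2))) := by
    refine ENNReal.tendsto_ofReal ?_
    have h : HasSum (fun i => (b.repr y i) ^ 2) (‖y‖ ^ 2) := by
      have h1 := lp.hasSum_norm (p := 2) (by norm_num) (b.repr y)
      simp only [ENNReal.toReal_ofNat, Real.rpow_two, Real.norm_eq_abs, sq_abs] at h1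
      rwa [b.repr.norm_map] at h1
    exact h
  have hrhs : Tendsto (fun F : Finset ι =>
      2 * Φ ((S y : FunctionSpaces.Torus.energySpace d) : Lp (EuclideanSpace ℝ d) 2 (volume : Measure (UnitAddTorus d))) +
        2 * ENNReal.ofReal (‖yF F - y‖ ^ 2)) atTop
      (𝓝 (2 * Φ ((S y : FunctionSpaces.Torus.energySpace d) :
        Lp (EuclideanSpace ℝ d) 2 (volume : Measure (UnitAddTorus d))) + 2 * 0)) := by
    refine tendsto_const_nhds.add (ENNReal.Tendsto.const_mul ?_ (Or.inr ENNReal.ofNat_ne_top))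
    rw [← ENNReal.ofReal_zero]
    refine ENNReal.tendsto_ofReal ?_
    have hy : Tendsto yF atTop (𝓝 y) := by
      rw [hyF]
      exact b.hasSum_repr y
    have h2 : Tendsto (fun F : Finset ι => yF F - y) atTop (𝓝 (y - y)) := hy.sub_const y
    rw [sub_self] at h2
    have h3 : Tendsto (fun F : Finset ι => ‖yF F - y‖ ^ 2) atTop
        (𝓝 (‖(0 : FunctionSpaces.Torus.energySpace d)‖ ^ 2)) :=
      ((continuous_norm.pow 2).tendsto 0).comp h2
    rwa [norm_zero, zero_pow two_ne_zero] at h3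
  have h := le_of_tendsto_of_tendsto' hlhs hrhs hbound
  rwa [mul_zero, add_zero] at h

/-! ### User-facing forms -/

/-- **The frame `S = (1 + A)^{-1/2}` is an `H → H¹` norm equivalence**: for every `y` in the energy space,
`‖∇(S y)‖₂² < ∞`, `‖S y‖² + ‖∇(S y)‖₂² ≤ ‖y‖²` and `‖y‖² ≤ 2 (‖S y‖² + ‖∇(S y)‖₂²)` — the frame bound
`Torus.tsum_one_add_stokesEigenvalue_mul_enorm_sq_le`, its reverse
`Torus.ofReal_norm_sq_le_two_mul_tsum_frame`, and the splitting
`Torus.tsum_one_add_stokesEigenvalue_mul_enorm_sq_eq_add` (Constantin–Foias 1988, Ch. 4, (4.11)–(4.13)).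
[cite: ConstantinFoiasNSE1988, Ch. 4 (4.11)–(4.13)] -/
theorem frame_norm_sq_equivalence {ι : Type*}
    (b : HilbertBasis ι ℝ (FunctionSpaces.Torus.energySpace d)) (m : ι → ℝ)
    (hb : ∀ i, ∃ (k : d → ℤ) (a : EuclideanSpace ℝ d) (c : Bool),
      ((b i : FunctionSpaces.Torus.energySpace d) :
          Lp (EuclideanSpace ℝ d) 2 (volume : Measure (UnitAddTorus d))) = stokesModeL2 k a c ∧
        m i = stokesEigenvalue k)
    (S : FunctionSpaces.Torus.energySpace d →L[ℝ] FunctionSpaces.Torus.energySpace d)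
    (hS : ∀ i, S (b i) = ((1 + m i) ^ (-(1 / 2 : ℝ))) • b i) (y : FunctionSpaces.Torus.energySpace d) :
    FunctionSpaces.Torus.eGradNormSq (((S y : FunctionSpaces.Torus.energySpace d) :
        Lp (EuclideanSpace ℝ d) 2 (volume : Measure (UnitAddTorus d))) : UnitAddTorus d → EuclideanSpace ℝ d) ≠ ⊤ ∧
      ‖S y‖ ^ 2 + (FunctionSpaces.Torus.eGradNormSq (((S y : FunctionSpaces.Torus.energySpace d) :
        Lp (EuclideanSpace ℝ d) 2 (volume : Measure (UnitAddTorus d))) : UnitAddTorus d → EuclideanSpace ℝ d)).toReal ≤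
        ‖y‖ ^ 2 ∧
      ‖y‖ ^ 2 ≤ 2 * (‖S y‖ ^ 2 + (FunctionSpaces.Torus.eGradNormSq (((S y : FunctionSpaces.Torus.energySpace d) :
        Lp (EuclideanSpace ℝ d) 2 (volume : Measure (UnitAddTorus d))) : UnitAddTorus d → EuclideanSpace ℝ d)).toReal) := by
  set v : Lp (EuclideanSpace ℝ d) 2 (volume : Measure (UnitAddTorus d)) :=
    ((S y : FunctionSpaces.Torus.energySpace d) : Lp (EuclideanSpace ℝ d) 2 (volume : Measure (UnitAddTorus d))) with hv
  have hup := tsum_one_add_stokesEigenvalue_mul_enorm_sq_le b m hb S hS y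
  have hlow := ofReal_norm_sq_le_two_mul_tsum_frame b m hb S hS y
  rw [tsum_one_add_stokesEigenvalue_mul_enorm_sq_eq_add v] at hup hlow
  have hnorm : ‖S y‖ = ‖v‖ := rfl
  have hfin : FunctionSpaces.Torus.eGradNormSq (v : UnitAddTorus d → EuclideanSpace ℝ d) ≠ ⊤ :=
    ne_top_of_le_ne_top ENNReal.ofReal_ne_top ((le_add_left le_rfl).trans hup)
  refine ⟨hfin, ?_, ?_⟩
  · rw [hnorm, ← ENNReal.ofReal_le_ofReal_iff (sq_nonneg _), ENNReal.ofReal_add (sq_nonneg _) ENNReal.toReal_nonneg,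
      ENNReal.ofReal_toReal hfin]
    exact hup
  · rw [hnorm, ← ENNReal.ofReal_le_ofReal_iff (by positivity), ENNReal.ofReal_mul zero_le_two, ENNReal.ofReal_ofNat,
      ENNReal.ofReal_add (sq_nonneg _) ENNReal.toReal_nonneg, ENNReal.ofReal_toReal hfin]
    exact hlow

end Torus

end Literature.Analysis.FluidPDE

end
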